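import Summits.MatrixMultiplication.MatrixMultiplication.Theorems.SoloInformedOneOneOneAlgebra
import Summits.MatrixMultiplication.MatrixMultiplication.Theorems.SoloInformedSquareZeroNormalForm
import Summits.MatrixMultiplication.MatrixMultiplication.Theorems.SoloInformedCatalystAbundance
import Mathlib.Analysis.Complex.Polynomial.Basic
import HarnessLib

/-!
# A square-zero triple in the 111-algebra forces `Q̃ < d`; the cw₂-power catalyst door is closed

Solo programme `solo-MatrixMultiplication-informed` (gen 18), door D10, Theorems N and E.

**Theorem N** (`asymptoticSubrank_lt_card_of_sqZero_triple`). Let `s ∈ ℂ^{d×d×d}` be `A`-concise and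
let `(P, Q, R) ∈ 𝔞(s)` (`P ·₁ s = Q ·₂ s = R ·₃ s`) with `P ≠ 0` and `P² = Q² = R² = 0`. Then the
coordinate tensor of `s` in adapted bases of the three legs is SL³-unstable (explicit one-parameter
subgroup with block weights `1 | ε | −λ` on `im | ker/im | complement`), hence `Q̃(s) < d`.
Support lemma: if the `A`-index of a non-zero entry lies in the complement block then the `B`- and
`C`-indices lie in the image block (and cyclically) — read off from `P̃ ·₁ s̃ = Q̃ ·₂ s̃ = R̃ ·₃ s̃` with
the normal forms.

**Corollary** (`asymptoticSubrank_lt_card_of_card_lt_finrank`). A concise `s ∈ ℂ^{d×d×d}` with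
`dim 𝔞(s) > d` has `Q̃(s) < d` (with `SoloInformedOneOneOneAlgebra`: E3 supplies the square-zero triple).

**Theorem E** (`not_cwTensor_two_pow_catalyst`). For every `N ≥ 1` and every concise
`s ∈ ℂ^{d×d×d}`: `¬ (R̲(cw₂^{⊠N} ⊕ s) ≤ 3^N + Q̃(s))`. (A certificate would give `R̲ ≤ 3^N + d`, hence
`dim 𝔞(s) > d` (`SoloInformedCatalystAbundance`), hence `Q̃(s) < d`, contradicting the flattening
lower bound `R̲(cw₂^{⊠N} ⊕ s) ≥ 3^N + d` for the concise direct sum.) So door D10 (beating `ω` via a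
Schönhage-type certificate with a power of `cw₂` as catalyst partner) is closed at every finite level.

References: [cite: BlaserLysikov2020, §2.3, Thm. 16, Thm. 17]; [cite: JelisiejewLandsbergPal2023, Thm. 1.10,
§1.4.1]; [cite: Schonhage1981, Thm. 5.2].
-/

open scoped BigOperators Matrix
open Matrix

namespace Summit.MatrixMultiplication.MatrixMultiplication.Theorems

open Literature.Computability.AlgebraicComplexity Literature.Barriers.MatrixMultiplication

namespace NilpotentUnstable

open SquareZeroNormalForm OneOneOneAlgebra

/-! ## Block weights on the adapted index type -/

section Weights

/-- `ε(n₁) = 1/(2 n₁ + 2)`. [folklore] -/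
noncomputable def eps (n₁ : ℕ) : ℝ := 1 / (2 * n₁ + 2)

/-- `λ(r, n₁) = (r + n₁ ε)/r`, the weight making the block weights sum to zero. [folklore] -/
noncomputable def lam (r n₁ : ℕ) : ℝ := (r + n₁ * eps n₁) / r

/-- Block weights `1 | ε | −λ` on `im | ker/im | complement`. [folklore] -/
noncomputable def wt (r n₁ : ℕ) : Blk r n₁ → ℝ :=
  Sum.elim (Sum.elim (fun _ => 1) (fun _ => eps n₁)) (fun _ => -lam r n₁)

/-- Weight `1` on the image block. [folklore] -/
@[simp] theorem wt_inl_inl (r n₁ : ℕ) (k : Fin r) : wt r n₁ (Sum.inl (Sum.inl k)) = 1 := rfl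
/-- Weight `ε` on the middle block. [folklore] -/
@[simp] theorem wt_inl_inr (r n₁ : ℕ) (k : Fin n₁) : wt r n₁ (Sum.inl (Sum.inr k)) = eps n₁ := rfl
/-- Weight `−λ` on the complement block. [folklore] -/
@[simp] theorem wt_inr (r n₁ : ℕ) (k : Fin r) : wt r n₁ (Sum.inr k) = -lam r n₁ := rfl

/-- `ε > 0`. [folklore] -/
theorem eps_pos (n₁ : ℕ) : 0 < eps n₁ := by unfold eps; positivity

/-- `ε ≤ w` on the kernel block. [folklore] -/
theorem eps_le_wt_inl (r n₁ : ℕ) (x : Fin r ⊕ Fin n₁) : eps n₁ ≤ wt r n₁ (Sum.inl x) := by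
  rcases x with k | k
  · rw [wt_inl_inl, eps, div_le_one (by positivity)]; linarith [(Nat.cast_nonneg n₁ : (0 : ℝ) ≤ n₁)]
  · rw [wt_inl_inr]

/-- `λ < 2` when `r ≥ 1`. [folklore] -/
theorem lam_lt_two {r : ℕ} (hr : 0 < r) (n₁ : ℕ) : lam r n₁ < 2 := by
  have hr' : (0 : ℝ) < r := by exact_mod_cast hr
  have hr1 : (1 : ℝ) ≤ r := by exact_mod_cast hr
  have h1 : (n₁ : ℝ) * eps n₁ < 1 := by
    rw [eps, mul_one_div, div_lt_one (by positivity)]; linarith [(Nat.cast_nonneg n₁ : (0 : ℝ) ≤ n₁)]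
  rw [lam, div_lt_iff₀ hr']; linarith

/-- The block weights sum to zero. [folklore] -/
theorem sum_wt {r : ℕ} (hr : 0 < r) (n₁ : ℕ) : ∑ i, wt r n₁ i = 0 := by
  have hr' : (r : ℝ) ≠ 0 := by exact_mod_cast hr.ne'
  simp only [Fintype.sum_sum_type, wt_inl_inl, wt_inl_inr, wt_inr, Finset.sum_const, Finset.card_univ,
    Fintype.card_fin, nsmul_eq_mul, lam]
  field_simp
  ring

/-- The image block. [folklore] -/
def IsTop {r n₁ : ℕ} (i : Blk r n₁) : Prop := ∃ k, i = Sum.inl (Sum.inl k)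

/-- Weight `1` on the image block. [folklore] -/
theorem wt_eq_one_of_isTop {r n₁ : ℕ} {i : Blk r n₁} (h : IsTop i) : wt r n₁ i = 1 := by
  obtain ⟨k, rfl⟩ := h; rfl

/-- Positivity of the total weight on an entry satisfying the support constraints. [folklore] -/
theorem wt_add_pos {rA nA rB nB rC nC : ℕ} (hrA : 0 < rA) (hrB : 0 < rB) (hrC : 0 < rC)
    (i : Blk rA nA) (j : Blk rB nB) (l : Blk rC nC)
    (hAB : ∀ k, i = Sum.inr k → IsTop j) (hAC : ∀ k, i = Sum.inr k → IsTop l)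
    (hBA : ∀ k, j = Sum.inr k → IsTop i) (hBC : ∀ k, j = Sum.inr k → IsTop l)
    (hCA : ∀ k, l = Sum.inr k → IsTop i) (hCB : ∀ k, l = Sum.inr k → IsTop j) :
    0 < wt rA nA i + wt rB nB j + wt rC nC l := by
  rcases i with x | k
  · rcases j with y | m
    · rcases l with w | o
      · linarith [eps_le_wt_inl rA nA x, eps_le_wt_inl rB nB y, eps_le_wt_inl rC nC w, eps_pos nA,
          eps_pos nB, eps_pos nC]
      · rw [wt_eq_one_of_isTop (hCA o rfl), wt_eq_one_of_isTop (hCB o rfl), wt_inr]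
        linarith [lam_lt_two hrC nC]
    · rw [wt_eq_one_of_isTop (hBA m rfl), wt_eq_one_of_isTop (hBC m rfl), wt_inr]
      linarith [lam_lt_two hrB nB]
  · rw [wt_eq_one_of_isTop (hAB k rfl), wt_eq_one_of_isTop (hAC k rfl), wt_inr]
    linarith [lam_lt_two hrA nA]

end Weights

/-! ## The support lemma -/

section Support

variable {K : Type*} [Field K] {rA nA rB nB rC nC : ℕ} {u : Blk rA nA → Blk rB nB → Blk rC nC → K}
  {NA : Matrix (Blk rA nA) (Blk rA nA) K} {NB : Matrix (Blk rB nB) (Blk rB nB) K}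
  {NC : Matrix (Blk rC nC) (Blk rC nC) K}

/-- Off the image block the indicator sum vanishes. [folklore] -/
theorem sum_ite_isTop_eq_zero {r n₁ : ℕ} {i : Blk r n₁} (hi : ¬ IsTop i) (f : Fin r → K) :
    (∑ k : Fin r, if i = Sum.inl (Sum.inl k) then f k else 0) = 0 :=
  Finset.sum_eq_zero fun k _ => if_neg fun h => hi ⟨k, h⟩

/-- On the image block the indicator sum picks one term. [folklore] -/
theorem sum_ite_top (r n₁ : ℕ) (k : Fin r) (f : Fin r → K) :
    (∑ k' : Fin r, if (Sum.inl (Sum.inl k) : Blk r n₁) = Sum.inl (Sum.inl k') then f k' else 0) = f k := by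
  simp only [Sum.inl.injEq, Finset.sum_ite_eq, Finset.mem_univ, if_true]

/-- `A → B`: an entry with `A`-index in the complement block has `B`-index in the image block. -/
theorem isTop_B_of_A (hA : IsNF NA) (hB : IsNF NB) (h : IsTriple u NA NB NC) (k : Fin rA)
    (j : Blk rB nB) (l : Blk rC nC) (hne : u (Sum.inr k) j l ≠ 0) : IsTop j := by
  by_contra hj
  have e := congr_fun (congr_fun (congr_fun h.1 (Sum.inl (Sum.inl k))) j) l
  rw [contract₁_isNF hA, contract₂_isNF hB, sum_ite_top, sum_ite_isTop_eq_zero hj] at e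
  exact hne e

/-- `A → C`. -/
theorem isTop_C_of_A (hA : IsNF NA) (hC : IsNF NC) (h : IsTriple u NA NB NC) (k : Fin rA)
    (j : Blk rB nB) (l : Blk rC nC) (hne : u (Sum.inr k) j l ≠ 0) : IsTop l := by
  by_contra hl
  have e := congr_fun (congr_fun (congr_fun (h.1.trans h.2) (Sum.inl (Sum.inl k))) j) l
  rw [contract₁_isNF hA, contract₃_isNF hC, sum_ite_top, sum_ite_isTop_eq_zero hl] at e
  exact hne e

/-- `B → A`. -/
theorem isTop_A_of_B (hA : IsNF NA) (hB : IsNF NB) (h : IsTriple u NA NB NC) (i : Blk rA nA)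
    (m : Fin rB) (l : Blk rC nC) (hne : u i (Sum.inr m) l ≠ 0) : IsTop i := by
  by_contra hi
  have e := congr_fun (congr_fun (congr_fun h.1 i) (Sum.inl (Sum.inl m))) l
  rw [contract₁_isNF hA, contract₂_isNF hB, sum_ite_top, sum_ite_isTop_eq_zero hi] at e
  exact hne e.symm

/-- `B → C`. -/
theorem isTop_C_of_B (hB : IsNF NB) (hC : IsNF NC) (h : IsTriple u NA NB NC) (i : Blk rA nA)
    (m : Fin rB) (l : Blk rC nC) (hne : u i (Sum.inr m) l ≠ 0) : IsTop l := by
  by_contra hl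
  have e := congr_fun (congr_fun (congr_fun h.2 i) (Sum.inl (Sum.inl m))) l
  rw [contract₂_isNF hB, contract₃_isNF hC, sum_ite_top, sum_ite_isTop_eq_zero hl] at e
  exact hne e

/-- `C → A`. -/
theorem isTop_A_of_C (hA : IsNF NA) (hC : IsNF NC) (h : IsTriple u NA NB NC) (i : Blk rA nA)
    (j : Blk rB nB) (o : Fin rC) (hne : u i j (Sum.inr o) ≠ 0) : IsTop i := by
  by_contra hi
  have e := congr_fun (congr_fun (congr_fun (h.1.trans h.2) i) j) (Sum.inl (Sum.inl o))
  rw [contract₁_isNF hA, contract₃_isNF hC, sum_ite_top, sum_ite_isTop_eq_zero hi] at e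
  exact hne e.symm

/-- `C → B`. -/
theorem isTop_B_of_C (hB : IsNF NB) (hC : IsNF NC) (h : IsTriple u NA NB NC) (i : Blk rA nA)
    (j : Blk rB nB) (o : Fin rC) (hne : u i j (Sum.inr o) ≠ 0) : IsTop j := by
  by_contra hj
  have e := congr_fun (congr_fun (congr_fun h.2 i) j) (Sum.inl (Sum.inl o))
  rw [contract₂_isNF hB, contract₃_isNF hC, sum_ite_top, sum_ite_isTop_eq_zero hj] at e
  exact hne e.symm

end Support

/-! ## Theorem N -/

section TheoremN

variable {ι κ μ : Type} [Fintype ι] [Fintype κ] [Fintype μ] [DecidableEq ι] [DecidableEq κ]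
  [DecidableEq μ]

omit [Fintype κ] [Fintype μ] [DecidableEq κ] [DecidableEq μ] in
/-- `P² = 0` as an endomorphism identity. [folklore] -/
theorem toLin'_toLin'_eq_zero {P : Matrix ι ι ℂ} (hP : P * P = 0) (v : ι → ℂ) :
    Matrix.toLin' P (Matrix.toLin' P v) = 0 := by
  simp [Matrix.toLin'_apply, Matrix.mulVec_mulVec, hP]

/-- **Theorem N.** An `A`-concise `s ∈ ℂ^{d×d×d}` whose 111-algebra contains a square-zero triple
`(P, Q, R)` with `P ≠ 0` has `Q̃(s) < d` (its coordinate tensor in adapted bases is unstable).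
[cite: BlaserLysikov2020, §2.3, Thm. 17] -/
theorem asymptoticSubrank_lt_card_of_sqZero_triple (s : ι → κ → μ → ℂ)
    (hAc : LinearIndependent ℂ fun a => s a) {d : ℕ} (hι : Fintype.card ι = d)
    (hκ : Fintype.card κ = d) (hμ : Fintype.card μ = d) {P : Matrix ι ι ℂ} {Q : Matrix κ κ ℂ}
    {Rm : Matrix μ μ ℂ} (htr : IsTriple s P Q Rm) (hP0 : P ≠ 0) (hP : P * P = 0) (hQ : Q * Q = 0)
    (hR : Rm * Rm = 0) : asymptoticSubrank ℂ s < d := by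
  -- `Q ≠ 0`, `R ≠ 0` by `A`-conciseness
  have hQ0 : Q ≠ 0 := by
    rintro rfl
    refine hP0 (eq_zero_of_contract₁_eq_zero hAc ?_)
    rw [htr.1]; funext a b c; simp [contract₂_apply]
  have hR0 : Rm ≠ 0 := by
    rintro rfl
    refine hP0 (eq_zero_of_contract₁_eq_zero hAc ?_)
    rw [htr.1, htr.2]; funext a b c; simp [contract₃_apply]
  -- adapted bases on the three legs
  obtain ⟨rA, nA, bA, hA1, hA2⟩ := exists_adapted_basis (Matrix.toLin' P) (toLin'_toLin'_eq_zero hP)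
  obtain ⟨rB, nB, bB, hB1, hB2⟩ := exists_adapted_basis (Matrix.toLin' Q) (toLin'_toLin'_eq_zero hQ)
  obtain ⟨rC, nC, bC, hC1, hC2⟩ := exists_adapted_basis (Matrix.toLin' Rm) (toLin'_toLin'_eq_zero hR)
  have hNA : IsNF (dualMat bA * P * vecMat bA) := isNF_of_adapted bA P hA1 hA2
  have hNB : IsNF (dualMat bB * Q * vecMat bB) := isNF_of_adapted bB Q hB1 hB2
  have hNC : IsNF (dualMat bC * Rm * vecMat bC) := isNF_of_adapted bC Rm hC1 hC2
  -- positive block sizes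
  have hrA : 0 < rA := by
    rcases Nat.eq_zero_or_pos rA with h0 | h0
    · subst h0; exact absurd (eq_zero_of_isNF_zero bA P hNA) hP0
    · exact h0
  have hrB : 0 < rB := by
    rcases Nat.eq_zero_or_pos rB with h0 | h0
    · subst h0; exact absurd (eq_zero_of_isNF_zero bB Q hNB) hQ0
    · exact h0
  have hrC : 0 < rC := by
    rcases Nat.eq_zero_or_pos rC with h0 | h0
    · subst h0; exact absurd (eq_zero_of_isNF_zero bC Rm hNC) hR0
    · exact h0
  -- the coordinate tensor and its triple in normal form
  set u := actTensor (dualMat bA) (dualMat bB) (dualMat bC) s with hu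
  have htr' : IsTriple u (dualMat bA * P * vecMat bA) (dualMat bB * Q * vecMat bB)
      (dualMat bC * Rm * vecMat bC) :=
    ⟨by rw [hu, contract₁_coords, contract₂_coords, htr.1],
      by rw [hu, contract₂_coords, contract₃_coords, htr.2]⟩
  -- instability of the coordinate tensor
  have hunst : IsUnstable u :=
    isUnstable_of_sepWeight u (wt rA nA) (wt rB nB) (wt rC nC) (sum_wt hrA nA) (sum_wt hrB nB)
      (sum_wt hrC nC) fun i j l hne =>
        wt_add_pos hrA hrB hrC i j l
          (fun k hk => isTop_B_of_A hNA hNB htr' k j l (hk ▸ hne))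
          (fun k hk => isTop_C_of_A hNA hNC htr' k j l (hk ▸ hne))
          (fun m hm => isTop_A_of_B hNA hNB htr' i m l (hm ▸ hne))
          (fun m hm => isTop_C_of_B hNB hNC htr' i m l (hm ▸ hne))
          (fun o ho => isTop_A_of_C hNA hNC htr' i j o (ho ▸ hne))
          (fun o ho => isTop_B_of_C hNB hNC htr' i j o (ho ▸ hne))
  -- cubic format `d ≥ 1`
  have hcA : Fintype.card (Blk rA nA) = d := by
    rw [← Module.finrank_eq_card_basis bA, Module.finrank_fintype_fun_eq_card, hι]
  have hcB : Fintype.card (Blk rB nB) = d := by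
    rw [← Module.finrank_eq_card_basis bB, Module.finrank_fintype_fun_eq_card, hκ]
  have hcC : Fintype.card (Blk rC nC) = d := by
    rw [← Module.finrank_eq_card_basis bC, Module.finrank_fintype_fun_eq_card, hμ]
  have hd : 0 < d := by
    rw [← hcA]; exact Fintype.card_pos_iff.2 ⟨Sum.inr ⟨0, hrA⟩⟩
  exact asymptoticSubrank_lt_of_isUnstable_restrictsTo hd hcA hcB hcC s hunst
    (restrictsTo_of_coords bA bB bC s)

/-- **Corollary.** A concise `s ∈ ℂ^{d×d×d}` whose 111-algebra has dimension `> d` satisfies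
`Q̃(s) < d`. [cite: JelisiejewLandsbergPal2023, Thm. 1.10, §1.4.1] -/
theorem asymptoticSubrank_lt_card_of_card_lt_finrank (s : ι → κ → μ → ℂ) (hs : IsConcise3 s)
    {d : ℕ} (hι : Fintype.card ι = d) (hκ : Fintype.card κ = d) (hμ : Fintype.card μ = d)
    (hlt : Fintype.card ι < Module.finrank ℂ (LinearMap.ker (lin111 s))) :
    asymptoticSubrank ℂ s < d := by
  obtain ⟨P, Q, Rm, hP0, hP, hQ, hR, htr⟩ := exists_sqZero_triple_of_card_lt_finrank_ker_lin111 s hs hlt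
  exact asymptoticSubrank_lt_card_of_sqZero_triple s hs.1 hι hκ hμ htr hP0 hP hQ hR

end TheoremN

/-! ## Theorem E: no cw₂-power catalyst certificate -/

section TheoremE

variable {ι' κ' μ' : Type} [Fintype ι'] [Fintype κ'] [Fintype μ'] [DecidableEq ι'] [DecidableEq κ']
  [DecidableEq μ']

/-- **Theorem E.** For every `N ≥ 1` and every concise `s ∈ ℂ^{d×d×d}` there is no Schönhage-type
certificate `R̲(cw₂^{⊠N} ⊕ s) ≤ 3^N + Q̃(s)`: door D10 is closed at every finite level.
[cite: BlaserLysikov2020, Thm. 16, Thm. 17]; [cite: JelisiejewLandsbergPal2023, §1.4.1] -/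
theorem not_cwTensor_two_pow_catalyst (s : ι' → κ' → μ' → ℂ) (hs : IsConcise3 s) {d : ℕ}
    (hι : Fintype.card ι' = d) (hκ : Fintype.card κ' = d) (hμ : Fintype.card μ' = d) {N : ℕ}
    (hN : N ≠ 0) :
    ¬ ((algBorderRank (directSumTensor (kroneckerPow (cwTensor ℂ 2) N) s) : ℝ) ≤
        3 ^ N + asymptoticSubrank ℂ s) := by
  intro hcert
  have hQle : asymptoticSubrank ℂ s ≤ d := hι ▸ (asymptoticSubrank_le_card₁₂₃ s).1
  -- the certificate as a natural-number bound
  have hcertN : algBorderRank (directSumTensor (kroneckerPow (cwTensor ℂ 2) N) s) ≤ 3 ^ N + d := by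
    have h : ((algBorderRank (directSumTensor (kroneckerPow (cwTensor ℂ 2) N) s) : ℕ) : ℝ) ≤
        ((3 ^ N + d : ℕ) : ℝ) := by push_cast; linarith
    exact_mod_cast h
  -- abundance, then `Q̃(s) < d`
  have hlt := lt_finrank_ker_lin111_of_cwTensor_two_catalyst (K := ℂ) s hs hι hκ hμ hN hcertN
  have hQlt := asymptoticSubrank_lt_card_of_card_lt_finrank s hs hι hκ hμ (hι.symm ▸ hlt)
  -- flattening lower bound for the concise direct sum
  have hconc := OneOneOneSplit.isConcise3_directSumTensor
    (isConcise3_kroneckerPow_cwTensor_two (K := ℂ) N) hs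
  have hlow := card_le_algBorderRank_of_linearIndependent _ hconc.1
  rw [Fintype.card_sum, Fintype.card_fun, Fintype.card_fin, Fintype.card_fin, hι] at hlow
  have hlow' : ((3 ^ N + d : ℕ) : ℝ) ≤ algBorderRank (directSumTensor (kroneckerPow (cwTensor ℂ 2) N) s) := by
    exact_mod_cast hlow
  push_cast at hlow'
  linarith

end TheoremE

end NilpotentUnstable

end Summit.MatrixMultiplication.MatrixMultiplication.Theorems
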